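import Summits.AnomalousDissipation.AnomalousDissipation.Theorems.SawtoothPulseCascadeK1LocalisedCascadeLag

/-!
# K1loc, line `Spectral` / SeqCone — helper: A LAG AT LEAST `i₀` (companion of `…K1LocalisedCascadeLedger`)

Helper file of the prover lane on the crux `K1LocalisedCascade` (stmt-AnomalousDissipation-19491), route
`SawtoothPulseCascade`.  The ledger theorem `…K1Ledger.highModeConcentration_of_ledger` wants a lag `A` that (i) passes the
slot-damping threshold `1 ≤ 8π²κ(cρ^{J})²·tHalf J`, `J = J_r(κ)+A`, for all `κ > 0` and (ii) is at least the start phase `i₀`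
of the first good piece.  `…K1Lag.exists_lag` gives (i) for SOME `A`; here `exists_lag_ge` gives it for some `A ≥ A₀`, any
`A₀` (apply `exists_lag` with the constant `cρ^{A₀}/(A₀+1)²` and lose `(A₀+1)⁴` on the phase clock,
`tHalf_div_le_tHalf_add`).  Kept in its own file because `…Lag` imports the route file.  Appendix: `exists_kappa_threshold` — below a
`κ`-threshold `κ₁` NO extra lag is needed (`A = 0`) and `J_r(κ) ≥ i₀`.  No definitions.
[cite: DEIJ2022, (1.2)–(1.3) (κ-uniform dissipation thresholds)] [problem: turb]
-/

-- `Summit.<Summit>.<Problem>`: single-conjunct summit, the duplicate namespace segment is deliberate.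
set_option linter.dupNamespace false

noncomputable section

namespace Summit.AnomalousDissipation.AnomalousDissipation.Theorems.SawtoothPulseCascade.K1Ledger

open Filter
open Literature.Analysis.FluidPDE.SawtoothCascade Literature.Analysis.FluidPDE.SawtoothCascade.CascadeParams
open Summit.AnomalousDissipation.AnomalousDissipation.Theorems.SawtoothPulseCascade.K1Lag

/-- The phase clock loses at most `(A₀+1)⁴` over `A₀` further phases: `tHalf J / (A₀+1)⁴ ≤ tHalf (J + A₀)`
(`(J+A₀+1) ≤ (J+1)(A₀+1)`). [folklore] -/
theorem tHalf_div_le_tHalf_add (J A₀ : ℕ) : tHalf J / ((A₀ : ℝ) + 1) ^ 4 ≤ tHalf (J + A₀) := by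
  unfold tHalf
  have hπ : 0 < Real.pi ^ 4 := by positivity
  have hJ : (0 : ℝ) < (J : ℝ) + 1 := by positivity
  have hA : (0 : ℝ) < (A₀ : ℝ) + 1 := by positivity
  have hle : ((J + A₀ : ℕ) : ℝ) + 1 ≤ ((J : ℝ) + 1) * ((A₀ : ℝ) + 1) := by
    push_cast; nlinarith [Nat.cast_nonneg (α := ℝ) J, Nat.cast_nonneg (α := ℝ) A₀]
  have hle4 : (((J + A₀ : ℕ) : ℝ) + 1) ^ 4 ≤ (((J : ℝ) + 1) * ((A₀ : ℝ) + 1)) ^ 4 :=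
    pow_le_pow_left₀ (by positivity) hle 4
  rw [div_div]
  refine div_le_div_of_nonneg_left (by norm_num) (by positivity) ?_
  calc Real.pi ^ 4 * (((J + A₀ : ℕ) : ℝ) + 1) ^ 4 ≤ Real.pi ^ 4 * ((((J : ℝ) + 1) * ((A₀ : ℝ) + 1)) ^ 4) := by
        gcongr
    _ = Real.pi ^ 4 * ((J : ℝ) + 1) ^ 4 * ((A₀ : ℝ) + 1) ^ 4 := by ring

/-- **A lag at least `A₀`.**  For `1 < r < ρ`, `c > 0` and any `A₀` there is a lag `A ≥ A₀` such that for ALL `κ > 0`, with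
`J = J_r(κ) + A`, the wavenumber `cρ^J` passes the slot-damping threshold of phase `J`: `1 ≤ 8π²κ(cρ^J)²·tHalf J`
(`…K1Lag.exists_lag` applied with the constant `cρ^{A₀}/(A₀+1)²`, then `tHalf_div_le_tHalf_add`).  The ledger needs
`A ≥ i₀`. [cite: DEIJ2022, (1.2)–(1.3)] -/
theorem exists_lag_ge {r ρ c : ℝ} (hr : 1 < r) (hρ : r < ρ) (hc : 0 < c) (A₀ : ℕ) :
    ∃ A : ℕ, A₀ ≤ A ∧ ∀ κ : ℝ, 0 < κ →
      1 ≤ 8 * Real.pi ^ 2 * κ * (c * ρ ^ (Jrate r κ + A)) ^ 2 * tHalf (Jrate r κ + A) := by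
  have hρ0 : 0 < ρ := by linarith
  have hA : (0 : ℝ) < (A₀ : ℝ) + 1 := by positivity
  set c' : ℝ := c * ρ ^ A₀ / ((A₀ : ℝ) + 1) ^ 2 with hc'
  have hc'0 : 0 < c' := by positivity
  obtain ⟨A₁, hA₁⟩ := exists_lag hr hρ hc'0
  refine ⟨A₁ + A₀, Nat.le_add_left A₀ A₁, fun κ hκ => ?_⟩
  have h := hA₁ κ hκ
  set J₁ : ℕ := Jrate r κ + A₁ with hJ₁
  have hJ : Jrate r κ + (A₁ + A₀) = J₁ + A₀ := by rw [hJ₁]; ring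
  rw [hJ]
  have ht := tHalf_div_le_tHalf_add J₁ A₀
  have hkey : (c' * ρ ^ J₁) ^ 2 * tHalf J₁ ≤ (c * ρ ^ (J₁ + A₀)) ^ 2 * tHalf (J₁ + A₀) := by
    have h1 : (c' * ρ ^ J₁) ^ 2 * tHalf J₁ = (c * ρ ^ (J₁ + A₀)) ^ 2 * (tHalf J₁ / ((A₀ : ℝ) + 1) ^ 4) := by
      rw [hc', pow_add]; field_simp; ring
    rw [h1]
    exact mul_le_mul_of_nonneg_left ht (sq_nonneg _)
  calc (1 : ℝ) ≤ 8 * Real.pi ^ 2 * κ * (c' * ρ ^ J₁) ^ 2 * tHalf J₁ := h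
    _ = 8 * Real.pi ^ 2 * κ * ((c' * ρ ^ J₁) ^ 2 * tHalf J₁) := by ring
    _ ≤ 8 * Real.pi ^ 2 * κ * ((c * ρ ^ (J₁ + A₀)) ^ 2 * tHalf (J₁ + A₀)) := by gcongr
    _ = _ := by ring

/-! ## Appendix: lag zero below a `κ`-threshold -/

/-- **No extra lag below a `κ`-threshold.**  For `1 < r < ρ`, `c > 0` and any `i₀` there is `κ₁ ∈ (0,1]` such that for
`0 < κ ≤ κ₁` the threshold phase `J = J_r(κ)` itself satisfies `i₀ ≤ J` and `1 ≤ 8π²κ(cρ^J)²·tHalf J` (lag `A = 0`): with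
`κ r^{2J} ≥ 1` (`…K1Lag.one_le_mul_pow_two_mul_Jrate`) one has `κ(cρ^J)²·tHalf J ≥ c²(ρ/r)^{2J}·45/(π⁴(J+1)⁴) → ∞`, and
`J_r(κ) ≥ log(1/κ)/(2 log r) → ∞` as `κ → 0`.  This is the form the ledger uses when the per-phase errors are majorised
only on the phases `j < J_r(κ)` (`…K1Ledger.mul_pow_lt_pow_of_lt_Jrate_add` with `A = 0`).
[cite: DEIJ2022, (1.2)–(1.3) (κ-uniform dissipation thresholds)] -/
theorem exists_kappa_threshold {r ρ c : ℝ} (hr : 1 < r) (hρ : r < ρ) (hc : 0 < c) (i₀ : ℕ) :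
    ∃ κ₁ : ℝ, 0 < κ₁ ∧ κ₁ ≤ 1 ∧ ∀ κ : ℝ, 0 < κ → κ ≤ κ₁ →
      i₀ ≤ Jrate r κ ∧ 1 ≤ 8 * Real.pi ^ 2 * κ * (c * ρ ^ Jrate r κ) ^ 2 * tHalf (Jrate r κ) := by
  have hr0 : 0 < r := zero_lt_one.trans hr
  have hρ0 : 0 < ρ := hr0.trans hρ
  have hlogr : 0 < Real.log r := Real.log_pos hr
  -- `q = (r/ρ)² ∈ (0,1)` and `(n+1)⁴ qⁿ → 0`
  set q : ℝ := (r / ρ) ^ 2 with hq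
  have hq0 : 0 < q := by positivity
  have hq1 : q < 1 := by
    rw [hq]
    have h1 : r / ρ < 1 := (div_lt_one hρ0).2 hρ
    have h0 : 0 ≤ r / ρ := by positivity
    nlinarith
  have ht := tendsto_pow_const_mul_const_pow_of_abs_lt_one 4 (show |q| < 1 by rwa [abs_of_nonneg hq0.le])
  have ht' : Tendsto (fun n : ℕ => (1 / q) * (((n + 1 : ℕ) : ℝ) ^ 4 * q ^ (n + 1))) atTop (nhds 0) := by
    have h := (ht.comp (tendsto_add_atTop_nat 1)).const_mul (1 / q)
    rw [mul_zero] at h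
    exact h
  have hf : ∀ n : ℕ, ((n : ℝ) + 1) ^ 4 * q ^ n = (1 / q) * (((n + 1 : ℕ) : ℝ) ^ 4 * q ^ (n + 1)) := fun n => by
    have hq' : q ≠ 0 := hq0.ne'
    push_cast
    field_simp
    ring
  set ε : ℝ := 360 * c ^ 2 / Real.pi ^ 2 with hε
  have hε0 : 0 < ε := by positivity
  obtain ⟨J₁, hJ₁⟩ := eventually_atTop.1 ((tendsto_order.1 ht').2 ε hε0)
  -- the threshold `κ₁`
  set Js : ℕ := max J₁ i₀ with hJs
  set κ₁ : ℝ := min 1 ((r ^ (2 * Js))⁻¹) with hκ₁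
  have hκ₁0 : 0 < κ₁ := lt_min zero_lt_one (by positivity)
  refine ⟨κ₁, hκ₁0, min_le_left _ _, fun κ hκ hκle => ?_⟩
  -- `Js ≤ J_r(κ)`
  have hJge : Js ≤ Jrate r κ := by
    have h1 : κ ≤ (r ^ (2 * Js))⁻¹ := hκle.trans (min_le_right _ _)
    have h2 : r ^ (2 * Js) ≤ 1 / κ := by
      rw [one_div]; exact (le_inv_comm₀ hκ (by positivity)).1 h1
    have h3 : (2 * Js : ℝ) * Real.log r ≤ Real.log (1 / κ) := by
      have := Real.log_le_log (by positivity) h2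
      rw [Real.log_pow] at this; push_cast at this; linarith
    have h4 : (Js : ℝ) ≤ Real.log (1 / κ) / (2 * Real.log r) := by
      rw [le_div_iff₀ (by positivity)]; linarith
    have h5 : (Js : ℝ) ≤ (Jrate r κ : ℝ) := by
      unfold Jrate; exact h4.trans (Nat.le_ceil _)
    exact_mod_cast h5
  refine ⟨(le_max_right _ _).trans hJge, ?_⟩
  -- the threshold inequality at `J = J_r(κ)`
  set J : ℕ := Jrate r κ with hJ
  have hJ₁J : J₁ ≤ J := (le_max_left _ _).trans hJge
  have hsmall : ((J : ℝ) + 1) ^ 4 * q ^ J ≤ ε := by rw [hf]; exact (hJ₁ J hJ₁J).le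
  have hκr : 1 ≤ κ * r ^ (2 * J) := one_le_mul_pow_two_mul_Jrate hr hκ
  have hqJ : q ^ J * ρ ^ (2 * J) = r ^ (2 * J) := by
    rw [hq, ← pow_mul, div_pow, pow_mul, pow_mul, div_mul_cancel₀]
    exact pow_ne_zero _ (pow_ne_zero _ hρ0.ne')
  have hκρ : 1 ≤ κ * ρ ^ (2 * J) * q ^ J := by
    calc (1 : ℝ) ≤ κ * r ^ (2 * J) := hκr
      _ = κ * ρ ^ (2 * J) * q ^ J := by rw [← hqJ]; ring
  unfold tHalf
  have hπ : 0 < Real.pi ^ 4 := by positivity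
  have hJ1 : 0 < ((J : ℝ) + 1) ^ 4 := by positivity
  rw [show 8 * Real.pi ^ 2 * κ * (c * ρ ^ J) ^ 2 * (45 / (Real.pi ^ 4 * ((J : ℝ) + 1) ^ 4)) =
      (360 * c ^ 2 / Real.pi ^ 2) * (κ * ρ ^ (2 * J)) / ((J : ℝ) + 1) ^ 4 by
    rw [pow_mul]; field_simp; ring]
  rw [← hε, le_div_iff₀ hJ1]
  -- `(J+1)⁴ ≤ (J+1)⁴ q^J · κρ^{2J} ≤ ε κ ρ^{2J}`
  have hκρ0 : 0 ≤ κ * ρ ^ (2 * J) := by positivity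
  calc (1 : ℝ) * ((J : ℝ) + 1) ^ 4 = ((J : ℝ) + 1) ^ 4 := one_mul _
    _ ≤ ((J : ℝ) + 1) ^ 4 * (κ * ρ ^ (2 * J) * q ^ J) := le_mul_of_one_le_right hJ1.le hκρ
    _ = (((J : ℝ) + 1) ^ 4 * q ^ J) * (κ * ρ ^ (2 * J)) := by ring
    _ ≤ ε * (κ * ρ ^ (2 * J)) := mul_le_mul_of_nonneg_right hsmall hκρ0

end Summit.AnomalousDissipation.AnomalousDissipation.Theorems.SawtoothPulseCascade.K1Ledger
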